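import Summits.QuantumFields.YangMills.Theorems.BalabanUVNodesPortS1ChartJacobianPi
import Summits.QuantumFields.YangMills.Theorems.BalabanUVNodesK0RecordFormatNamesFluct

/-!
# NODE O port PT-A — socket (o2) = brick (h2) AT THE RECORD: print's «dV ↦ dB′σ(B′)» ([I] (2.10) p.267) READ AT ★★ DEF-1's names — the flat fluctuation coordinates `x : FluctIdx F k K → ℝ`
# (✓`…K0RecordFormatNamesFluct` :66), `fluctMat F k K x b = Σ_a x(b,a)•iσ_a` (:72), `pert F k K V^{(k)} x = (exp(fluctMat x b)·V^{(k)}(b))_b` (:79, [I] (2.4) `V = V′V^{(k)}`), the cell's product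
# Haar measure `fieldMeasure (F.P K) k (SU 2) = ⊗_b dV(b)` — THE (2.10) JACOBIAN FACE: `∫_{window around V^{(k)}} G dV = σ₀^{#T_k} · ∫_{|x_b| < s ∀ b} G(pert V^{(k)} x) · Π_b chartJac(x_b) dx`,
# `dx` Lebesgue measure on `FluctIdx F k K → ℝ`, `s ≤ π`

Cell `ym-nodeO-ideate`, porter seat `ymgap-nodeO-port-PTA-1` (gen 9); `--kind definition --supports stmt-QuantumFields-27930 --as helper`; sequel of ✓`…PortS1ChartJacobian` (one bond ∕ many bonds on
`ι → EuclideanSpace ℝ (Fin 3)`).  [I] = [Balaban1987RG1] (2.4) p.266, (2.10) p.267; [16] = [Balaban1985UV3] (18) p.260.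

CONTENT (sorry-free):
* §1 def `fluctVec F k K : (FluctIdx F k K → ℝ) ≃ᵐ VecField (F.P K) k (EuclideanSpace ℝ (Fin 3))` — DEF-1's flat coordinates read as print's 𝔤-valued field `B′` on the level-`k` bonds (the carrier
  `VecField P k 𝔤`, `𝔤 = fluctG3`, of `B12Eq213Body268.FluctData.onBondsPrinted` and of `B12SmallFieldDomain259.chiFluctPrinted`); `fluctVec_apply` (`(fluctVec x b) a = x (b, a)`), ★
  `measurePreserving_fluctVec` (Lebesgue on `FluctIdx → ℝ` ↦ Lebesgue on `bonds → ℝ³`: currying × `PiLp.volume_preserving_toLp`), `norm_fluctVec_apply` (`|B′(b)| = √(Σ_a x(b,a)²)` — the radicand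
  of DEF-1's `chiRem`).
* §2 ★ `su2Gen_eq_smul_pauli`, ★ `fluctMat_eq_su2Coord` (DEF-1's `Σ_a x(b,a)•su2Gen a` IS r07's Pauli coordinate `B10Eq18SigmaSU2.su2Coord (x(b,·))`), ★ `pert_apply_eq_chartAt` ∕ `pert_eq_chartPi`
  (DEF-1's `pert F k K Vk x` IS the product Pauli chart `chartPi Vk (fluctVec x)` of ✓`…PortS1ChartJacobian`).
* §3 ★★★ `setLIntegral_fieldMeasure_pert_window` — THE (2.10) JACOBIAN FACE AT THE RECORD (every measurable `G ≥ 0`, every centre `Vk`, `s ≤ π`), and ★★ `setIntegral_fieldMeasure_pert_window`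
  (Bochner form, real Banach values); `fieldMeasure_restrict_window_eq` (measure form).

HONEST FRAMING.  Bookkeeping: DEF-1's coordinates identified with r07's Pauli chart and the many-bond Jacobian identity of the prequel transported along a Lebesgue-preserving equivalence; NOTHING
of Bałaban's renormalization-group estimates asserted, ported or discharged; sockets (o1) `D̃`, (o3) `Tr log(1 − hδD̃∕δB)`, (o4) `E_k` in the chart NOT here; `stub_P0C` ∕ `stub_FE` OPEN;
⟨27930⟩ ⁸-Ax-LR4 OPEN · no claim; NODE O 0∕1; COUNT 8∕28 · K 1∕4 UNMOVED; finite `𝕋⁴_{L^K}` at fixed ε — NOT continuum ∕ OS ∕ Clay; **the Yang–Mills mass gap is NOT proved by any of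
this.**  No `sorry`, no `instance`, no `notation`; standard axioms.
-/

noncomputable section

open MeasureTheory MeasureTheory.Measure Set Metric
open scoped ENNReal BigOperators

namespace Summit.QuantumFields.YangMills.Theorems.BalabanUVNodesPortS1

open Literature.MathematicalPhysics.QuantumFieldTheory (haarProbability)
open Literature.MathematicalPhysics.QuantumFieldTheory.Balaban1983to89
open Literature.MathematicalPhysics.QuantumFieldTheory.Balaban1983to89.Node00
open Literature.MathematicalPhysics.QuantumFieldTheory.Balaban1983to89.T4Continuum (T4Family)
open Literature.MathematicalPhysics.QuantumFieldTheory.Balaban1983to89.B10Eq22Rescaling (sigmaSU2 sigmaSU2_zero)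
open Literature.MathematicalPhysics.QuantumFieldTheory.Balaban1983to89.B10Eq18SigmaSU2Haar (expPauli coe_expPauli)
open Summit.QuantumFields.YangMills.Theorems.K0RecordFormatNames (su2Gen FluctIdx fluctMat pert)
open NormedSpace (exp)

variable (F : T4Family)

/-! ## §1  DEF-1's flat coordinates as print's 𝔤-valued fluctuation field `B′` -/

section FluctVec

/-- ★ **THE FLAT COORDINATES `x : FluctIdx F k K → ℝ` READ AS THE 𝔤-VALUED FIELD `B′ : bonds → ℝ³`** (`(B′(b))^a = x(b, a)`), as a measurable equivalence (currying, then the Euclidean structure on each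
`ℝ³`); its target `VecField (F.P K) k (EuclideanSpace ℝ (Fin 3))` is the carrier of print's `χ_k` (`B12SmallFieldDomain259.chiFluctPrinted`) and of the fluctuation datum
`B12Eq213Body268.FluctData.onBondsPrinted`. [cite: Balaban1987RG1, (2.4) p.266, (2.9) p.266] -/
def fluctVec (k K : ℕ) : (FluctIdx F k K → ℝ) ≃ᵐ VecField (F.P K) k (EuclideanSpace ℝ (Fin 3)) :=
  (MeasurableEquiv.curry (PBond (F.P K) k) (Fin 3) ℝ).trans (MeasurableEquiv.piCongrRight fun _ => MeasurableEquiv.toLp 2 (Fin 3 → ℝ))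

/-- Coordinates: `(fluctVec x b) a = x (b, a)`. [cite: Balaban1987RG1, (2.4) p.266] -/
@[simp] theorem fluctVec_apply (k K : ℕ) (x : FluctIdx F k K → ℝ) (b : PBond (F.P K) k) (a : Fin 3) : fluctVec F k K x b a = x (b, a) := rfl

/-- The bond vector is `toLp 2 (x(b, ·))`. [folklore] -/
theorem fluctVec_apply_eq_toLp (k K : ℕ) (x : FluctIdx F k K → ℝ) (b : PBond (F.P K) k) : fluctVec F k K x b = WithLp.toLp 2 (fun a => x (b, a)) := rfl

/-- The inverse reading: `(fluctVec.symm B′) (b, a) = (B′ b) a`. [cite: Balaban1987RG1, (2.4) p.266] -/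
@[simp] theorem fluctVec_symm_apply (k K : ℕ) (B' : VecField (F.P K) k (EuclideanSpace ℝ (Fin 3))) (b : PBond (F.P K) k) (a : Fin 3) :
    (fluctVec F k K).symm B' (b, a) = B' b a := rfl

/-- ★ **`fluctVec` PRESERVES LEBESGUE MEASURE**: `dx` on `FluctIdx F k K → ℝ` is carried to `Π_b d³B′(b)` on `bonds → ℝ³` (currying preserves the product Lebesgue measure; `toLp 2` is volume
preserving on each `ℝ³`, Mathlib `PiLp.volume_preserving_toLp`). [folklore] -/
theorem measurePreserving_fluctVec (k K : ℕ) : MeasurePreserving (fluctVec F k K) volume volume :=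
  ((measurePreserving_uncurry (PBond (F.P K) k) (Fin 3)).symm _).trans (volume_preserving_pi fun _ : PBond (F.P K) k => PiLp.volume_preserving_toLp (Fin 3))

/-- `|B′(b)| = √(Σ_a x(b,a)²)` — the Euclidean norm of the bond vector is the radicand DEF-1's `chiRem` tests against `ε₁`. [cite: Balaban1987RG1, (2.9) p.266] -/
theorem norm_fluctVec_apply (k K : ℕ) (x : FluctIdx F k K → ℝ) (b : PBond (F.P K) k) : ‖fluctVec F k K x b‖ = √(∑ a : Fin 3, x (b, a) ^ 2) := by
  rw [EuclideanSpace.norm_eq]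
  congr 1
  exact Finset.sum_congr rfl fun a _ => by rw [fluctVec_apply, Real.norm_eq_abs, sq_abs]

/-- The flat window `{x : |x_b| < s ∀ b}` is the preimage of the product ball. [cite: Balaban1987RG1, (2.9) p.266] -/
theorem fluctVec_preimage_pi_ball (k K : ℕ) (s : ℝ) :
    fluctVec F k K ⁻¹' Set.pi univ (fun _ => ball (0 : EuclideanSpace ℝ (Fin 3)) s) = {x | ∀ b : PBond (F.P K) k, √(∑ a : Fin 3, x (b, a) ^ 2) < s} := by
  ext x
  simp only [mem_preimage, mem_univ_pi, mem_ball_zero_iff, norm_fluctVec_apply, mem_setOf_eq]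

/-- The flat window is Borel. [folklore] -/
theorem measurableSet_fluctWindow (k K : ℕ) (s : ℝ) : MeasurableSet {x : FluctIdx F k K → ℝ | ∀ b : PBond (F.P K) k, √(∑ a : Fin 3, x (b, a) ^ 2) < s} := by
  rw [← fluctVec_preimage_pi_ball]
  exact (fluctVec F k K).measurable (MeasurableSet.univ_pi fun _ => measurableSet_ball)

end FluctVec

/-! ## §2  DEF-1's `fluctMat` ∕ `pert` ARE the Pauli chart of r07 ∕ the product chart `chartPi` -/

section Chart

/-- ★ DEF-1's anti-Hermitian generators are `i` times r07's Pauli matrices: `su2Gen a = i • σ_a`. [cite: Balaban1987RG1, (2.4) p.266 (bookkeeping)] [cite: Balaban1985UV3, p.260] -/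
theorem su2Gen_eq_smul_pauli (a : Fin 3) : su2Gen a = Complex.I • B10Eq18SigmaSU2.pauli a := by
  fin_cases a <;>
  · ext i j
    fin_cases i <;> fin_cases j <;> simp [su2Gen, B10Eq18SigmaSU2.pauli]

/-- ★ **DEF-1's `fluctMat` IS r07's PAULI COORDINATE**: `Σ_a x(b,a) • su2Gen a = su2Coord (x(b, ·)) = iΣ_a x(b,a)σ_a`. [cite: Balaban1987RG1, (2.4) p.266] [cite: Balaban1985UV3, p.260] -/
theorem fluctMat_eq_su2Coord (k K : ℕ) (x : FluctIdx F k K → ℝ) (b : PBond (F.P K) k) :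
    fluctMat F k K x b = B10Eq18SigmaSU2.su2Coord (fun a => x (b, a)) := by
  rw [fluctMat, B10Eq18SigmaSU2.su2Coord_eq_sum]
  refine Finset.sum_congr rfl fun a _ => ?_
  rw [su2Gen_eq_smul_pauli, smul_smul]

/-- The same with the bond vector of `fluctVec` (`su2Coord` reads the coordinates of `toLp 2 (x(b,·))`). [cite: Balaban1987RG1, (2.4) p.266] -/
theorem fluctMat_eq_su2Coord_fluctVec (k K : ℕ) (x : FluctIdx F k K → ℝ) (b : PBond (F.P K) k) :
    fluctMat F k K x b = B10Eq18SigmaSU2.su2Coord (fluctVec F k K x b) := fluctMat_eq_su2Coord F k K x b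

/-- ★ **DEF-1's `pert` IS THE TRANSLATED PAULI CHART, bond by bond**: `pert F k K Vk x b = expPauli (B′(b)) · Vk b = chartAt (Vk b) (B′(b))`, `B′ = fluctVec x`.
[cite: Balaban1987RG1, (2.4) p.266] -/
theorem pert_apply_eq_chartAt (k K : ℕ) (Vk : GaugeField (F.P K) k (SU 2)) (x : FluctIdx F k K → ℝ) (b : PBond (F.P K) k) :
    pert F k K Vk x b = chartAt (Vk b) (fluctVec F k K x b) := by
  have hmem : exp (fluctMat F k K x b) ∈ Matrix.specialUnitaryGroup (Fin 2) ℂ := by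
    rw [fluctMat_eq_su2Coord_fluctVec]
    exact (expPauli (fluctVec F k K x b)).2
  rw [chartAt_apply]
  show suOfMat 2 (exp (fluctMat F k K x b)) * Vk b = expPauli (fluctVec F k K x b) * Vk b
  rw [suOfMat_of_mem hmem]
  congr 1
  apply Subtype.ext
  show exp (fluctMat F k K x b) = ((expPauli (fluctVec F k K x b) : Matrix.specialUnitaryGroup (Fin 2) ℂ) : Matrix (Fin 2) (Fin 2) ℂ)
  rw [coe_expPauli, fluctMat_eq_su2Coord_fluctVec]

/-- ★ **`pert F k K Vk x = chartPi Vk (fluctVec x)`** — DEF-1's perturbation map IS the product Pauli chart of ✓`…PortS1ChartJacobianPi` centred at `Vk`, read through `fluctVec`.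
[cite: Balaban1987RG1, (2.4) p.266] -/
theorem pert_eq_chartPi (k K : ℕ) (Vk : GaugeField (F.P K) k (SU 2)) (x : FluctIdx F k K → ℝ) :
    pert F k K Vk x = chartPi Vk (fluctVec F k K x) :=
  funext fun b => pert_apply_eq_chartAt F k K Vk x b

/-- The same as an identity of maps: `pert F k K Vk = chartPi Vk ∘ fluctVec`. [cite: Balaban1987RG1, (2.4) p.266] -/
theorem pert_eq_chartPi_comp (k K : ℕ) (Vk : GaugeField (F.P K) k (SU 2)) :
    pert F k K Vk = chartPi Vk ∘ fluctVec F k K :=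
  funext fun x => pert_eq_chartPi F k K Vk x

/-- `x ↦ pert F k K Vk x` is measurable (a continuous chart read through a measurable equivalence). [folklore] -/
theorem measurable_pert (k K : ℕ) (Vk : GaugeField (F.P K) k (SU 2)) : Measurable (pert F k K Vk) := by
  have h : Measurable (chartPi Vk ∘ fluctVec F k K) := (measurable_chartPi Vk).comp (fluctVec F k K).measurable
  rw [← pert_eq_chartPi_comp] at h
  exact h

end Chart

/-! ## §3  THE (2.10) JACOBIAN FACE AT THE RECORD -/

section Record

/-- A measurable equivalence transports densities: `(e_*μ)·g = e_*(μ·(g ∘ e))`. [folklore] -/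
theorem withDensity_map_equiv {α β : Type*} [MeasurableSpace α] [MeasurableSpace β] (e : α ≃ᵐ β) (μ : Measure α) (g : β → ℝ≥0∞) :
    (μ.map e).withDensity g = (μ.withDensity (g ∘ e)).map e := by
  ext t ht
  rw [withDensity_apply _ ht, e.measurableEmbedding.restrict_map, e.measurableEmbedding.lintegral_map, e.map_apply,
    withDensity_apply _ (e.measurable ht)]
  rfl

/-- The cell's product Haar measure of the level-`k` bond variables is the product of the normalised Haar measures of `SU(2)` (`rfl`: `fieldMeasure = ⊗_b HaarData.haar`, and `HaarData.haar =
haarProbability` for `UnitaryModel`'s instance). [cite: Balaban1985Averaging, (10) p.19] -/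
theorem fieldMeasure_eq_pi_haarProbability (K k : ℕ) :
    fieldMeasure (F.P K) k (SU 2) = Measure.pi fun _ : PBond (F.P K) k => haarProbability (Matrix.specialUnitaryGroup (Fin 2) ℂ) := rfl

/-- print's window around the background in the chart, `{V : V(b) = exp(iA_b)·Vk(b), |A_b| < s ∀ b}`, is Borel for `s ≤ π`. [cite: Balaban1987RG1, (2.4) p.266, (2.9) p.266] -/
theorem measurableSet_pertWindow (K k : ℕ) (Vk : GaugeField (F.P K) k (SU 2)) {s : ℝ} (hs : s ≤ Real.pi) :
    MeasurableSet (Set.pi univ fun b : PBond (F.P K) k => chartAt (Vk b) '' ball (0 : EuclideanSpace ℝ (Fin 3)) s : Set (GaugeField (F.P K) k (SU 2))) :=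
  MeasurableSet.univ_pi fun b => measurableSet_image_chartAt (Vk b) measurableSet_ball (ball_subset_ball hs)

/-- The window is the image of the flat window `{x : |x_b| < s ∀ b}` under DEF-1's `pert`. [cite: Balaban1987RG1, (2.4) p.266, (2.9) p.266] -/
theorem image_pert_fluctWindow (K k : ℕ) (Vk : GaugeField (F.P K) k (SU 2)) (s : ℝ) :
    pert F k K Vk '' {x | ∀ b : PBond (F.P K) k, √(∑ a : Fin 3, x (b, a) ^ 2) < s} =
      (Set.pi univ fun b : PBond (F.P K) k => chartAt (Vk b) '' ball (0 : EuclideanSpace ℝ (Fin 3)) s : Set (GaugeField (F.P K) k (SU 2))) := by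
  ext V
  constructor
  · rintro ⟨x, hx, rfl⟩
    refine fun b _ => ⟨fluctVec F k K x b, ?_, (pert_apply_eq_chartAt F k K Vk x b).symm⟩
    rw [mem_ball_zero_iff, norm_fluctVec_apply]
    exact hx b
  · intro h
    have h' : ∀ b : PBond (F.P K) k, ∃ A ∈ ball (0 : EuclideanSpace ℝ (Fin 3)) s, chartAt (Vk b) A = V b := fun b => h b (mem_univ b)
    choose A hA hAV using h'
    refine ⟨(fluctVec F k K).symm A, fun b => ?_, ?_⟩
    · have hb := hA b
      rw [mem_ball_zero_iff] at hb
      rw [← norm_fluctVec_apply, (fluctVec F k K).apply_symm_apply]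
      exact hb
    · funext b
      rw [pert_apply_eq_chartAt, (fluctVec F k K).apply_symm_apply]
      exact hAV b

/-- Transport of the product-window Lebesgue-with-density measure along `fluctVec`: `(σ · dA)|_{B_s^{bonds}} = (fluctVec)_*((σ ∘ fluctVec) · dx|_{flat window})`. [folklore] -/
theorem volume_restrict_pi_ball_withDensity_eq_map (K k : ℕ) (s : ℝ) :
    ((volume : Measure (VecField (F.P K) k (EuclideanSpace ℝ (Fin 3)))).restrict (Set.pi univ fun _ => ball (0 : EuclideanSpace ℝ (Fin 3)) s)).withDensity
        (fun A => ENNReal.ofReal (fluctSigma A)) =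
      (((volume : Measure (FluctIdx F k K → ℝ)).restrict {x | ∀ b : PBond (F.P K) k, √(∑ a : Fin 3, x (b, a) ^ 2) < s}).withDensity
          fun x => ENNReal.ofReal (fluctSigma (fluctVec F k K x))).map (fluctVec F k K) := by
  have hvol : (volume : Measure (VecField (F.P K) k (EuclideanSpace ℝ (Fin 3)))) = (volume : Measure (FluctIdx F k K → ℝ)).map (fluctVec F k K) :=
    (measurePreserving_fluctVec F k K).map_eq.symm
  rw [hvol, (fluctVec F k K).measurableEmbedding.restrict_map, fluctVec_preimage_pi_ball, withDensity_map_equiv]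
  rfl

/-- ★★ **MEASURE FORM AT THE RECORD**: `dV|_{window around Vk} = σ₀^{#T_k} • (pert Vk)_*((Π_b chartJac(x_b)) · dx|_{flat window})`, `s ≤ π`, `dV = fieldMeasure`, `dx` Lebesgue on `FluctIdx F k K → ℝ`.
[cite: Balaban1987RG1, (2.4) p.266, (2.10) p.267] [cite: Balaban1985UV3, (18) p.260] -/
theorem fieldMeasure_restrict_window_eq (K k : ℕ) (Vk : GaugeField (F.P K) k (SU 2)) {s : ℝ} (hs : s ≤ Real.pi) :
    (fieldMeasure (F.P K) k (SU 2)).restrict (Set.pi univ fun b : PBond (F.P K) k => chartAt (Vk b) '' ball (0 : EuclideanSpace ℝ (Fin 3)) s) =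
      ENNReal.ofReal (sigmaSU2 0) ^ Fintype.card (PBond (F.P K) k) •
        (((volume : Measure (FluctIdx F k K → ℝ)).restrict {x | ∀ b : PBond (F.P K) k, √(∑ a : Fin 3, x (b, a) ^ 2) < s}).withDensity
          fun x => ENNReal.ofReal (fluctSigma (fluctVec F k K x))).map (pert F k K Vk) := by
  have key := pi_haar_restrict_chartPi_image (ι := PBond (F.P K) k) Vk hs
  rw [volume_restrict_pi_ball_withDensity_eq_map F K k s, Measure.map_map (measurable_chartPi Vk) (fluctVec F k K).measurable,
    ← pert_eq_chartPi_comp] at key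
  exact key

/-- ★★★ **THE (2.10) JACOBIAN FACE AT THE RECORD, EVERY MEASURABLE INTEGRAND**: for every background `Vk`, radius `s ≤ π` and measurable `G ≥ 0` on the level-`k` configurations,
`∫_{{V : V(b) = exp(iA_b)·Vk(b), |A_b|<s ∀ b}} G dV = σ₀^{#T_k} · ∫_{{x : √(Σ_a x(b,a)²) < s ∀ b}} G(pert F k K Vk x) · Π_b chartJac(x_b) dx` — print's «∫dV … = 𝐍* ∫ dB′σ(B′) …», the `σ₀`'s displayed,
in DEF-1's coordinates. [cite: Balaban1987RG1, (2.4) p.266, (2.10) p.267] [cite: Balaban1985UV3, (13) p.259, (18) p.260] -/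
theorem setLIntegral_fieldMeasure_pert_window (K k : ℕ) (Vk : GaugeField (F.P K) k (SU 2)) {s : ℝ} (hs : s ≤ Real.pi)
    (G : GaugeField (F.P K) k (SU 2) → ℝ≥0∞) (hG : Measurable G) :
    ∫⁻ V in Set.pi univ (fun b : PBond (F.P K) k => chartAt (Vk b) '' ball (0 : EuclideanSpace ℝ (Fin 3)) s), G V ∂(fieldMeasure (F.P K) k (SU 2)) =
      ENNReal.ofReal (sigmaSU2 0) ^ Fintype.card (PBond (F.P K) k) *
        ∫⁻ x in {x | ∀ b : PBond (F.P K) k, √(∑ a : Fin 3, x (b, a) ^ 2) < s}, G (pert F k K Vk x) * ENNReal.ofReal (fluctSigma (fluctVec F k K x)) := by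
  have key := setLIntegral_pi_haar_chartPi_image (ι := PBond (F.P K) k) Vk hs G hG
  rw [← (measurePreserving_fluctVec F k K).setLIntegral_comp_preimage_emb (fluctVec F k K).measurableEmbedding
    (fun A => G (chartPi Vk A) * ENNReal.ofReal (fluctSigma A)) (Set.pi univ fun _ => ball (0 : EuclideanSpace ℝ (Fin 3)) s)] at key
  simp only [fluctVec_preimage_pi_ball, ← pert_eq_chartPi] at key
  exact key

/-- ★★ **BOCHNER FORM AT THE RECORD**: for `f` a.e.-strongly measurable on the window (real Banach values),
`∫_{window around Vk} f dV = σ₀^{#T_k} · ∫_{flat window} σ(fluctVec x) • f(pert F k K Vk x) dx`. [cite: Balaban1987RG1, (2.4) p.266, (2.10) p.267] [cite: Balaban1985UV3, (18) p.260] -/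
theorem setIntegral_fieldMeasure_pert_window {G : Type*} [NormedAddCommGroup G] [NormedSpace ℝ G] (K k : ℕ) (Vk : GaugeField (F.P K) k (SU 2)) {s : ℝ} (hs : s ≤ Real.pi)
    (f : GaugeField (F.P K) k (SU 2) → G)
    (hf : AEStronglyMeasurable f ((fieldMeasure (F.P K) k (SU 2)).restrict (Set.pi univ fun b : PBond (F.P K) k => chartAt (Vk b) '' ball (0 : EuclideanSpace ℝ (Fin 3)) s))) :
    ∫ V in Set.pi univ (fun b : PBond (F.P K) k => chartAt (Vk b) '' ball (0 : EuclideanSpace ℝ (Fin 3)) s), f V ∂(fieldMeasure (F.P K) k (SU 2)) =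
      (sigmaSU2 0) ^ Fintype.card (PBond (F.P K) k) •
        ∫ x in {x | ∀ b : PBond (F.P K) k, √(∑ a : Fin 3, x (b, a) ^ 2) < s}, fluctSigma (fluctVec F k K x) • f (pert F k K Vk x) := by
  have key := setIntegral_pi_haar_chartPi_image (ι := PBond (F.P K) k) Vk hs f hf
  rw [← (measurePreserving_fluctVec F k K).setIntegral_preimage_emb (fluctVec F k K).measurableEmbedding
    (fun A => fluctSigma A • f (chartPi Vk A)) (Set.pi univ fun _ => ball (0 : EuclideanSpace ℝ (Fin 3)) s)] at key
  simp only [fluctVec_preimage_pi_ball, ← pert_eq_chartPi] at key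
  exact key

/-- The Jacobian at the record in closed form: `σ(fluctVec x) = Π_b (sin|x_b|∕|x_b|)²`, `|x_b| = √(Σ_a x(b,a)²)` — the factor that enters the exponent of (2.12) as `Σ_b log (sin|x_b|∕|x_b|)²`.
[cite: Balaban1987RG1, (2.10) p.267, (2.12) p.268] -/
theorem fluctSigma_fluctVec_eq (k K : ℕ) (x : FluctIdx F k K → ℝ) :
    fluctSigma (fluctVec F k K x) = ∏ b : PBond (F.P K) k, Real.sinc (√(∑ a : Fin 3, x (b, a) ^ 2)) ^ 2 := by
  unfold fluctSigma
  exact Finset.prod_congr rfl fun b _ => by rw [chartJac_eq_sinc_sq, norm_fluctVec_apply]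

end Record

end Summit.QuantumFields.YangMills.Theorems.BalabanUVNodesPortS1

end
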